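import Literature.Computability.QuantumComplexity.GadgetInstances
import Literature.Computability.QuantumComplexity.LetterControls
import Literature.Computability.Complexity.TrigDyadicFP
import HarnessLib

/-!
# Constant thresholds as Boolean expressions and the entry bound of a dyadic phase gadget

Topic `Literature/Computability/QuantumComplexity`, a sequel of `GadgetInstances.lean` (sign predicates
and entry bounds of the AJL gadgets, whose thresholds are algebraic constants decided by polynomial
inequalities) for phases whose real and imaginary parts are only known through DYADIC approximations —
the controlled phases `e(1/2^m)` of the quantum Fourier transform (Nielsen–Chuang 2010, §5.1) in Regev's
quantum sampler (Regev 2009, Lemma 3.14), realised by the Clifford+`T` phase gadget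
(`PhaseGadgetAssemblyGen.phaseGadget_implOn_gen`):

* `SLP.constE w T` — the constant `T mod 2^w` as an arithmetic expression (a sum of the powers `2^j` of
  its bits; `constE_eval`, bounds `constE_bnd_le`, `constE_maxBnd_le`, side condition `constE_ok`);
  `SLP.ltConstB k w T` — the threshold `n < T` on the `k`-bit input field (`ltConstB_eval`), hence
  **`SLP.encodesEntry_ltConstB`**: it encodes `1 − 2T/2^k` (`encodesEntry_of_threshold`);
* `SLP.qftCtlB k` (the control condition "both phase wires read `1`", bits `k+2`, `k+3` of the gadget
  input), `SLP.qftPhaseB k Tre Tim` (the sign predicate `phaseSignB` with the two thresholds) and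
  **`SLP.qftPhase_entry_bound`** — for ANY target scalar `u₀`, the gadget quantity is within
  `4/2^k + ‖c̃ − u₀‖` of `−(if control then u₀ else 1)`, `c̃ = (2Tre/2^k − 1) + i(2Tim/2^k − 1)`;
* the concrete thresholds `SLP.cosThr`, `SLP.sinThr` from `TrigDyadic.cosDyadic/sinDyadic` (clamped to
  `[0, 2^k]`) with **`SLP.norm_dyadicPhase_sub_le`**: `‖c̃ − e^{2πi/2^m}‖ ≤ 4/2^k`.

Everything here is proved; definitions have bodies; no named fact is introduced.

## References

* M. A. Nielsen, I. L. Chuang, *Quantum Computation and Quantum Information*, CUP 2010, §5.1 (the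
  phases `R_k`), §4.5.3 [NielsenChuang2010].
* O. Regev, *On lattices, learning with errors, random linear codes, and cryptography*, J. ACM 56
  (2009), art. 34, Lemma 3.14 (proof), §2 p. 11 (finite precision) [Regev2009].
* D. W. Berry, A. M. Childs, R. Cleve, R. Kothari, R. D. Somma, STOC 2014, Lemma 3.1 [BerryEtAl2014].
-/

noncomputable section

namespace Literature.Computability.QuantumComplexity

namespace SLP

open Real Finset Literature.Computability.Complexity

/-! ### Constants as expressions -/

/-- **The constant `T mod 2^w`** as an arithmetic expression: the sum of the powers of two of its bits
below `w`. [folklore] -/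
def constE : ℕ → ℕ → AExpr
  | 0, _ => zeroE
  | w + 1, T => if T.testBit w then .add (constE w T) (.pw w) 0 else constE w T

/-- `constE w T` evaluates to `T mod 2^w`. [folklore] -/
theorem constE_eval (inp : ℕ) : ∀ (w T : ℕ), (constE w T).eval inp = T % 2 ^ w
  | 0, T => by simp [constE, zeroE, AExpr.eval, Nat.mod_one]
  | w + 1, T => by
    rw [Nat.mod_pow_succ, ← Nat.toNat_testBit]
    unfold constE
    cases hT : T.testBit w
    · simp only [Bool.false_eq_true, ↓reduceIte, Bool.toNat_false, mul_zero, add_zero]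
      exact constE_eval inp w T
    · simp only [↓reduceIte, AExpr.eval, Bool.toNat_true, mul_one, pow_zero]
      rw [constE_eval inp w T]

/-- The bound of `constE w T` is at most `2^w`. [folklore] -/
theorem constE_bnd_le : ∀ (w T : ℕ), (constE w T).bnd ≤ 2 ^ w
  | 0, _ => by simp [constE, zeroE, AExpr.bnd]
  | w + 1, T => by
    unfold constE
    have ih := constE_bnd_le w T
    split_ifs
    · simp only [AExpr.bnd, pow_zero, mul_one, pow_succ]; omega
    · rw [pow_succ]; omega

/-- The intermediate bound of `constE w T` is at most `2^w`. [folklore] -/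
theorem constE_maxBnd_le : ∀ (w T : ℕ), (constE w T).maxBnd ≤ 2 ^ w
  | 0, _ => by simp [constE, zeroE, AExpr.maxBnd, AExpr.bnd]
  | w + 1, T => by
    unfold constE
    have ih := constE_maxBnd_le w T
    have hb := constE_bnd_le w T
    split_ifs
    · simp only [AExpr.maxBnd, AExpr.bnd, pow_zero, mul_one]
      refine max_le ?_ (max_le (ih.trans (by rw [pow_succ]; omega)) (by rw [pow_succ]; omega))
      rw [pow_succ]; omega
    · exact ih.trans (by rw [pow_succ]; omega)

/-- Side conditions of `constE w T`: widths `w ≤ Wd`. [folklore] -/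
theorem constE_ok {Wd kIn : ℕ} : ∀ (w T : ℕ), w ≤ Wd → (constE w T).OK Wd kIn
  | 0, _, _ => by simp [constE, zeroE, AExpr.OK]
  | w + 1, T, hw => by
    unfold constE
    split_ifs
    · exact ⟨constE_ok w T (by omega), show w < Wd by omega⟩
    · exact constE_ok w T (by omega)

/-! ### Thresholds `n < T` -/

/-- **The threshold `n < T`** on the `k`-bit input field (`T` written on `w` bits). [folklore] -/
def ltConstB (k w T : ℕ) : BExpr := .lt (aE k) (constE w T)

/-- Semantics of `ltConstB` for `T < 2^w`. [folklore] -/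
theorem ltConstB_eval {k w T : ℕ} (hT : T < 2 ^ w) (inp : ℕ) : (ltConstB k w T).eval inp = decide (inp % 2 ^ k < T) := by
  simp only [ltConstB, BExpr.eval, aE, AExpr.eval, pow_zero, Nat.div_one, constE_eval, Nat.mod_eq_of_lt hT]

/-- Side conditions of `ltConstB`. [folklore] -/
theorem ltConstB_ok {Wd kIn k w T : ℕ} (hk : k ≤ kIn) (hkW : k ≤ Wd) (hw : w ≤ Wd) : (ltConstB k w T).OK Wd kIn :=
  ⟨⟨by simpa using hk, hkW⟩, constE_ok w T hw⟩

/-- Intermediate bound of `ltConstB`. [folklore] -/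
theorem ltConstB_maxBnd_le (k w T : ℕ) : (ltConstB k w T).maxBnd ≤ max (2 ^ k) (2 ^ w) := by
  simp only [ltConstB, BExpr.maxBnd, aE, AExpr.maxBnd, AExpr.bnd]
  exact max_le_max le_rfl (constE_maxBnd_le w T)

/-- **A constant threshold encodes `1 − 2T/2^k`** (`T ≤ 2^k`). [cite: BerryEtAl2014, Lemma 3.1] -/
theorem encodesEntry_ltConstB {k w T : ℕ} (hT : T ≤ 2 ^ k) (hw : T < 2 ^ w) :
    EncodesEntry k (ltConstB k w T) (1 - 2 * ((T : ℝ) / 2 ^ k)) := by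
  refine encodesEntry_of_threshold (by positivity) ?_ fun inp => ?_
  · rw [div_le_one (by positivity)]; exact_mod_cast hT
  · rw [ltConstB_eval hw, mul_div_cancel₀ _ (by positivity)]
    by_cases h : inp % 2 ^ k < T
    · rw [decide_eq_true h, decide_eq_true (by exact_mod_cast h)]
    · rw [decide_eq_false h, decide_eq_false (by exact_mod_cast h)]

/-! ### The sign predicate of a dyadic controlled phase -/

/-- **The control condition of a QFT phase**: both phase wires (bits `k+2`, `k+3` of the gadget input)
read `1`. [cite: NielsenChuang2010, §5.1] -/
def qftCtlB (k : ℕ) : BExpr := conjB (k + 2) [true, true]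

/-- The control condition reads only high bits. [folklore] -/
theorem qftCtlB_readsHigh (k : ℕ) : (qftCtlB k).ReadsHigh (k + 2) := conjB_readsHigh le_rfl _ (by simp)

/-- Semantics of the control condition on `2^{k+2}·rest`. [folklore] -/
theorem qftCtlB_eval_high (k rest : ℕ) : (qftCtlB k).eval (2 ^ (k + 2) * rest) = (rest.testBit 0 && rest.testBit 1) := by
  rw [qftCtlB, conjB_eval]
  have h0 : (2 ^ (k + 2) * rest).testBit (k + 2 + 0) = rest.testBit 0 := testBit_two_pow_mul (k + 2) rest 0
  have h1 : (2 ^ (k + 2) * rest).testBit (k + 2 + 1) = rest.testBit 1 := testBit_two_pow_mul (k + 2) rest 1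
  apply Bool.eq_iff_iff.2
  simp only [decide_eq_true_eq, List.length_cons, List.length_nil, Bool.and_eq_true]
  constructor
  · intro h
    exact ⟨by simpa [h0] using h 0 (by omega), by simpa [h1] using h 1 (by omega)⟩
  · rintro ⟨ha, hb⟩ j hj
    interval_cases j
    · simpa [h0] using ha
    · simpa [h1] using hb

/-- **The sign predicate of a dyadic controlled phase**: `phaseSignB` with the QFT control condition and
the two constant thresholds (`w = k + 1` bits). [cite: NielsenChuang2010, §5.1] [cite: BerryEtAl2014, Lemma 3.1] -/
def qftPhaseB (k Tre Tim : ℕ) : BExpr := phaseSignB k (qftCtlB k) (ltConstB k (k + 1) Tre) (ltConstB k (k + 1) Tim)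

/-- **The entry bound of a dyadic controlled phase gadget.** For thresholds `Tre, Tim ≤ 2^k` and ANY
scalar `u₀`: the gadget quantity is within `4/2^k + ‖c̃ − u₀‖` of `−(if control then u₀ else 1)`,
`c̃ = (2Tre/2^k − 1) + i(2Tim/2^k − 1)` (`phaseSign_entry_bound` for `c̃`, then the triangle inequality).
[cite: BerryEtAl2014, Lemma 3.1] [cite: NielsenChuang2010, §4.5.3] -/
theorem qftPhase_entry_bound (k : ℕ) {Tre Tim : ℕ} (hTre : Tre ≤ 2 ^ k) (hTim : Tim ≤ 2 ^ k) (u₀ : ℂ) (zt : Bool) (rest : ℕ) :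
    ‖(((1 : ℂ) - 2 * (((Finset.range (2 ^ k)).filter fun n =>
        (qftPhaseB k Tre Tim).eval (2 ^ k * hiOf false zt rest + n) = true).card : ℂ) / 2 ^ k) +
        Complex.I * ((1 : ℂ) - 2 * (((Finset.range (2 ^ k)).filter fun n =>
          (qftPhaseB k Tre Tim).eval (2 ^ k * hiOf true zt rest + n) = true).card : ℂ) / 2 ^ k)) -
        (-(if (qftCtlB k).eval (2 ^ (k + 2) * rest) then u₀ else 1))‖ ≤
      4 / 2 ^ k + ‖(((2 * ((Tre : ℝ) / 2 ^ k) - 1 : ℝ) : ℂ) + Complex.I * (((2 * ((Tim : ℝ) / 2 ^ k) - 1 : ℝ) : ℂ))) - u₀‖ := by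
  set c : ℂ := (((2 * ((Tre : ℝ) / 2 ^ k) - 1 : ℝ) : ℂ) + Complex.I * (((2 * ((Tim : ℝ) / 2 ^ k) - 1 : ℝ) : ℂ))) with hc
  have hlt : 2 ^ k < 2 ^ (k + 1) := Nat.pow_lt_pow_right (by norm_num) (Nat.lt_succ_self k)
  have hcre : c.re = 2 * ((Tre : ℝ) / 2 ^ k) - 1 := by
    rw [hc]
    simp only [Complex.add_re, Complex.ofReal_re, Complex.mul_re, Complex.I_re, Complex.I_im, Complex.ofReal_im,
      zero_mul, mul_zero, sub_zero, add_zero]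
  have hcim : c.im = 2 * ((Tim : ℝ) / 2 ^ k) - 1 := by
    rw [hc]
    simp only [Complex.add_im, Complex.ofReal_im, Complex.mul_im, Complex.I_re, Complex.I_im, Complex.ofReal_re,
      zero_mul, one_mul, zero_add]
  have hre : EncodesEntry k (ltConstB k (k + 1) Tre) (-c.re) := by
    have h := encodesEntry_ltConstB hTre (lt_of_le_of_lt hTre hlt)
    have : -c.re = 1 - 2 * ((Tre : ℝ) / 2 ^ k) := by rw [hcre]; ring
    rwa [this]
  have him : EncodesEntry k (ltConstB k (k + 1) Tim) (-c.im) := by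
    have h := encodesEntry_ltConstB hTim (lt_of_le_of_lt hTim hlt)
    have : -c.im = 1 - 2 * ((Tim : ℝ) / 2 ^ k) := by rw [hcim]; ring
    rwa [this]
  have key := phaseSign_entry_bound k (qftCtlB_readsHigh k) hre him zt rest
  rw [← qftPhaseB] at key
  -- triangle inequality from `c` to `u₀`
  set X : ℂ := ((1 : ℂ) - 2 * (((Finset.range (2 ^ k)).filter fun n =>
        (qftPhaseB k Tre Tim).eval (2 ^ k * hiOf false zt rest + n) = true).card : ℂ) / 2 ^ k) +
        Complex.I * ((1 : ℂ) - 2 * (((Finset.range (2 ^ k)).filter fun n =>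
          (qftPhaseB k Tre Tim).eval (2 ^ k * hiOf true zt rest + n) = true).card : ℂ) / 2 ^ k) with hX
  by_cases hctl : (qftCtlB k).eval (2 ^ (k + 2) * rest) = true
  · rw [hctl, if_pos rfl] at key ⊢
    calc ‖X - -u₀‖ ≤ ‖X - -c‖ + ‖-c - -u₀‖ := norm_sub_le_norm_sub_add_norm_sub _ _ _
      _ ≤ 4 / 2 ^ k + ‖c - u₀‖ := add_le_add key (by rw [neg_sub_neg, norm_sub_rev])
  · rw [Bool.not_eq_true] at hctl
    rw [hctl] at key ⊢
    simp only [Bool.false_eq_true, ↓reduceIte] at key ⊢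
    exact key.trans (le_add_of_nonneg_right (norm_nonneg _))

/-! ### The thresholds of `e(1/2^m)` -/

/-- **The real threshold of the phase `e^{2πi/2^m}`**: `2^{k-1} + cosDyadic`, clamped to `[0, 2^k]`
(`k ≥ 1`). [cite: NielsenChuang2010, §5.1] -/
def cosThr (m k : ℕ) : ℕ := min (2 ^ k) ((2 : ℤ) ^ (k - 1) + TrigDyadic.cosDyadic m (k - 1)).toNat

/-- **The imaginary threshold**: `2^{k-1} + sinDyadic`, clamped to `[0, 2^k]`. [cite: NielsenChuang2010, §5.1] -/
def sinThr (m k : ℕ) : ℕ := min (2 ^ k) ((2 : ℤ) ^ (k - 1) + TrigDyadic.sinDyadic m (k - 1)).toNat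

/-- `cosThr ≤ 2^k`. [folklore] -/
theorem cosThr_le (m k : ℕ) : cosThr m k ≤ 2 ^ k := min_le_left _ _

/-- `sinThr ≤ 2^k`. [folklore] -/
theorem sinThr_le (m k : ℕ) : sinThr m k ≤ 2 ^ k := min_le_left _ _

/-- **Clamping a dyadic approximation of a value in `[−1, 1]` keeps the accuracy**: if
`|v − t/2^{k-1}| ≤ ε` with `|v| ≤ 1` (`k ≥ 1`), then `|v − (2·clamp(2^{k-1}+t)/2^k − 1)| ≤ ε`. [folklore] -/
theorem abs_sub_clamp_le {k : ℕ} (hk : 1 ≤ k) {v ε : ℝ} {t : ℤ} (hv : |v| ≤ 1) (h : |v - (t : ℝ) / 2 ^ (k - 1)| ≤ ε) :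
    |v - (2 * (((min (2 ^ k) ((2 : ℤ) ^ (k - 1) + t).toNat : ℕ) : ℝ) / 2 ^ k) - 1)| ≤ ε := by
  obtain ⟨k', rfl⟩ := Nat.exists_eq_add_of_le hk
  simp only [Nat.add_sub_cancel_left] at h ⊢
  have h2 : (2 : ℝ) ^ (1 + k') = 2 * 2 ^ k' := by rw [pow_add, pow_one]
  have hpos : (0 : ℝ) < 2 ^ k' := by positivity
  rw [abs_le] at hv h ⊢
  obtain ⟨hv1, hv2⟩ := hv
  obtain ⟨h1, h3⟩ := h
  -- the unclamped value `t/2^{k'}` and the clamped numerator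
  set s : ℤ := (2 : ℤ) ^ k' + t with hs
  have hval : ∀ T : ℕ, (2 * ((T : ℝ) / 2 ^ (1 + k')) - 1) = ((T : ℝ) - 2 ^ k') / 2 ^ k' := by
    intro T; rw [h2]; field_simp
  rw [hval]
  -- case analysis on the clamp
  by_cases hneg : s < 0
  · -- clamped below to `0`: the true value `v ≥ -1 = (0 - 2^k')/2^k'`, and `t/2^k' < -1 ≤ v`
    have hT : (min (2 ^ (1 + k')) s.toNat : ℕ) = 0 := by rw [Int.toNat_of_nonpos hneg.le, Nat.min_zero]
    rw [hT]
    have hts : (t : ℝ) / 2 ^ k' < -1 := by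
      rw [div_lt_iff₀ hpos]
      have : (s : ℝ) < 0 := by exact_mod_cast hneg
      rw [hs] at this; push_cast at this; linarith
    have hzero : (((0 : ℕ) : ℝ) - 2 ^ k') / 2 ^ k' = -1 := by rw [Nat.cast_zero, zero_sub, neg_div, div_self hpos.ne']
    rw [hzero]
    constructor <;> linarith
  · push Not at hneg
    by_cases hbig : (2 : ℤ) ^ (1 + k') ≤ s
    · -- clamped above to `2^k`: value `1 ≥ v`, and `t/2^k' ≥ 1 ≥ v`
      have hT : (min (2 ^ (1 + k')) s.toNat : ℕ) = 2 ^ (1 + k') := by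
        rw [min_eq_left]; zify; rw [Int.toNat_of_nonneg hneg]; exact_mod_cast hbig
      rw [hT]
      have hts : (1 : ℝ) ≤ (t : ℝ) / 2 ^ k' := by
        rw [le_div_iff₀ hpos]
        have : ((2 : ℤ) ^ (1 + k') : ℝ) ≤ (s : ℝ) := by exact_mod_cast hbig
        rw [hs] at this; push_cast at this; rw [pow_add, pow_one] at this; linarith
      have hone : (((2 ^ (1 + k') : ℕ) : ℝ) - 2 ^ k') / 2 ^ k' = 1 := by
        push_cast; rw [h2]; field_simp; ring
      rw [hone]
      constructor <;> linarith
    · -- no clamping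
      push Not at hbig
      have hT : ((min (2 ^ (1 + k')) s.toNat : ℕ) : ℝ) = (s : ℝ) := by
        have h1' : (min (2 ^ (1 + k')) s.toNat : ℕ) = s.toNat := by
          rw [min_eq_right]; zify; rw [Int.toNat_of_nonneg hneg]; exact_mod_cast hbig.le
        rw [h1']
        have : ((s.toNat : ℕ) : ℤ) = s := Int.toNat_of_nonneg hneg
        exact_mod_cast this
      rw [hT, hs]
      push_cast
      rw [show ((2 : ℝ) ^ k' + t - 2 ^ k') / 2 ^ k' = (t : ℝ) / 2 ^ k' by ring]
      exact ⟨h1, h3⟩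

/-- **The dyadic phase is within `4/2^k` of `e^{2πi/2^m}`** (`k ≥ 1`).
[cite: Regev2009, §2 p. 11 (finite precision)] [cite: NielsenChuang2010, §5.1] -/
theorem norm_dyadicPhase_sub_le (m : ℕ) {k : ℕ} (hk : 1 ≤ k) :
    ‖(((2 * ((cosThr m k : ℝ) / 2 ^ k) - 1 : ℝ) : ℂ) + Complex.I * (((2 * ((sinThr m k : ℝ) / 2 ^ k) - 1 : ℝ) : ℂ))) -
        Complex.exp (2 * Real.pi * Complex.I / 2 ^ m)‖ ≤ 4 / 2 ^ k := by
  have hcos := abs_sub_clamp_le hk (Real.abs_cos_le_one _) (TrigDyadic.abs_cos_sub_cosDyadic_div_le m (k - 1))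
  have hsin := abs_sub_clamp_le hk (Real.abs_sin_le_one _) (TrigDyadic.abs_sin_sub_sinDyadic_div_le m (k - 1))
  rw [← cosThr] at hcos
  rw [← sinThr] at hsin
  have hexp : Complex.exp (2 * Real.pi * Complex.I / 2 ^ m) =
      ((Real.cos (2 * Real.pi / 2 ^ m) : ℝ) : ℂ) + Complex.I * ((Real.sin (2 * Real.pi / 2 ^ m) : ℝ) : ℂ) := by
    rw [show (2 * Real.pi * Complex.I / 2 ^ m : ℂ) = ((2 * Real.pi / 2 ^ m : ℝ) : ℂ) * Complex.I by push_cast; ring,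
      Complex.exp_mul_I]
    push_cast; ring
  rw [hexp]
  have hk1 : (1 : ℝ) / 2 ^ (k - 1) = 2 / 2 ^ k := by
    obtain ⟨k', rfl⟩ := Nat.exists_eq_add_of_le hk
    rw [Nat.add_sub_cancel_left, pow_add, pow_one]; field_simp
  rw [hk1] at hcos hsin
  calc ‖(((2 * ((cosThr m k : ℝ) / 2 ^ k) - 1 : ℝ) : ℂ) + Complex.I * (((2 * ((sinThr m k : ℝ) / 2 ^ k) - 1 : ℝ) : ℂ))) -
        (((Real.cos (2 * Real.pi / 2 ^ m) : ℝ) : ℂ) + Complex.I * ((Real.sin (2 * Real.pi / 2 ^ m) : ℝ) : ℂ))‖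
      = ‖(((2 * ((cosThr m k : ℝ) / 2 ^ k) - 1 - Real.cos (2 * Real.pi / 2 ^ m) : ℝ)) : ℂ) +
          Complex.I * (((2 * ((sinThr m k : ℝ) / 2 ^ k) - 1 - Real.sin (2 * Real.pi / 2 ^ m) : ℝ)) : ℂ)‖ := by
        congr 1; push_cast; ring
    _ ≤ ‖(((2 * ((cosThr m k : ℝ) / 2 ^ k) - 1 - Real.cos (2 * Real.pi / 2 ^ m) : ℝ)) : ℂ)‖ +
          ‖Complex.I * (((2 * ((sinThr m k : ℝ) / 2 ^ k) - 1 - Real.sin (2 * Real.pi / 2 ^ m) : ℝ)) : ℂ)‖ := norm_add_le _ _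
    _ ≤ 2 / 2 ^ k + 2 / 2 ^ k := by
        rw [norm_mul, Complex.norm_I, one_mul, Complex.norm_real, Complex.norm_real, Real.norm_eq_abs, Real.norm_eq_abs,
          abs_sub_comm, abs_sub_comm (2 * ((sinThr m k : ℝ) / 2 ^ k) - 1)]
        exact add_le_add hcos hsin
    _ = 4 / 2 ^ k := by ring

end SLP

end Literature.Computability.QuantumComplexity

end
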